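import Summits.Ventures.PercRepro.KleitmanQ4
import Summits.Ventures.PercRepro.CodeTypes

/-!
# Piece (K) of the 8-point code bound, wired: every type has at most six members

Fix a type `(i, j)` of the code and pick `τ` of type `(j, k)` and `τ'` of type `(k, i)` (`k` the third
colour). Bipartitions of different types are orthogonal (`card_inter_eq_two_of_types_ne`), so `τ`, `τ'`
cut `Fin 8` into four quadrants of two elements and every member `σ` of type `(i, j)` meets `τ` and `τ'`
in two elements each: either `σ` is a union of two opposite quadrants (at most one such member — the two
candidates are complementary) or `σ` picks one element from each quadrant. Two members of the same type
meet in `2` or `3` points (`card_inter_mem_of_type_eq`), i.e. their quadrant choices agree in at least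
two quadrants; Kleitman's bound in `Q₄` (`kleitman_fun`) allows at most five choice functions with
pairwise at most two disagreements. Hence `|typeRep C cl i j| ≤ 6` — the hypothesis `hK` of
`codeBound8Fin_of_rank_of_kleitman`.
-/

namespace PercRepro

open Finset

/-- For a two-element set `{u, v}` and a set meeting it in exactly one element, the meet is `{v}` if
`v` belongs to the set and `{u}` otherwise. -/
theorem inter_pair_eq {u v : Fin 8} (huv : u ≠ v) {σ : Finset (Fin 8)} (h1 : (σ ∩ {u, v}).card = 1) :
    σ ∩ {u, v} = if v ∈ σ then {v} else {u} := by
  classical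
  split_ifs with hv
  · symm
    apply Finset.eq_of_subset_of_card_le
    · intro x hx; rw [Finset.mem_singleton] at hx; subst hx
      exact Finset.mem_inter.2 ⟨hv, by simp⟩
    · rw [Finset.card_singleton, h1]
  · obtain ⟨x, hx⟩ := Finset.card_eq_one.1 h1
    have hxmem : x ∈ σ ∩ {u, v} := by rw [hx]; exact Finset.mem_singleton_self x
    rw [Finset.mem_inter, Finset.mem_insert, Finset.mem_singleton] at hxmem
    rcases hxmem with ⟨hxσ, rfl | rfl⟩
    · exact hx
    · exact absurd hxσ hv

/-- The meet of two such sets inside the pair counts the agreement of their choices. -/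
theorem card_inter_inter_pair {u v : Fin 8} (huv : u ≠ v) {σ σ' : Finset (Fin 8)}
    (h1 : (σ ∩ {u, v}).card = 1) (h1' : (σ' ∩ {u, v}).card = 1) :
    (σ ∩ σ' ∩ {u, v}).card = if decide (v ∈ σ) = decide (v ∈ σ') then 1 else 0 := by
  classical
  have e : σ ∩ σ' ∩ {u, v} = (σ ∩ {u, v}) ∩ (σ' ∩ {u, v}) := by
    ext x; simp only [Finset.mem_inter]; tauto
  rw [e, inter_pair_eq huv h1, inter_pair_eq huv h1']
  by_cases hv : v ∈ σ <;> by_cases hv' : v ∈ σ' <;> simp [hv, hv', huv, Ne.symm huv]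

/-- `|A| = |A ∩ τ ∩ τ'| + |A ∩ τ ∩ τ'ᶜ| + |A ∩ τᶜ ∩ τ'| + |A ∩ τᶜ ∩ τ'ᶜ|`. -/
theorem card_eq_sum_quadrants (A τ τ' : Finset (Fin 8)) :
    A.card = (A ∩ τ ∩ τ').card + (A ∩ τ ∩ τ'ᶜ).card + (A ∩ τᶜ ∩ τ').card + (A ∩ τᶜ ∩ τ'ᶜ).card := by
  have h1 := card_inter_add_card_inter_compl A τ
  have h2 := card_inter_add_card_inter_compl (A ∩ τ) τ'
  have h3 := card_inter_add_card_inter_compl (A ∩ τᶜ) τ'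
  omega

section Quadrants

variable (C : Finset (Finset (Fin 8))) (cl : Finset (Fin 8) → Fin 3)
  (h4 : ∀ σ ∈ C, σ.card = 4) (hcompl : ∀ σ ∈ C, σᶜ ∈ C) (hcl : ∀ σ ∈ C, cl σᶜ ≠ cl σ)
  (hne : ∀ σ ∈ C, ∀ τ ∈ C, cl σ ≠ cl τ → (σ ∩ τ).card ≤ 2)
  (hocc : ∀ i j : Fin 3, i ≠ j → ∃ σ ∈ C, cl σ = i ∧ cl σᶜ = j)

include h4 hcompl hcl hne hocc in
/-- **Every type has at most six members** (the hypothesis `hK` of `codeBound8Fin_of_rank_of_kleitman`). -/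
theorem card_typeRep_le_six (i j : Fin 3) (hij : i ≠ j) : (typeRep C cl i j).card ≤ 6 := by
  classical
  -- the third colour and two bipartitions of the other two types
  have key : ∀ i j : Fin 3, i ≠ j → ∃ k : Fin 3, k ≠ i ∧ k ≠ j := by decide
  obtain ⟨k, hki, hkj⟩ := key i j hij
  obtain ⟨τ, hτC, hτj, hτk⟩ := hocc j k (Ne.symm hkj)
  obtain ⟨τ', hτ'C, hτ'k, hτ'i⟩ := hocc k i hki
  have hτT : τ ∈ typeRep C cl j k := mem_typeRep.2 ⟨hτC, hτj, hτk⟩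
  have hτ'T : τ' ∈ typeRep C cl k i := mem_typeRep.2 ⟨hτ'C, hτ'k, hτ'i⟩
  have hτ4 : τ.card = 4 := h4 τ hτC
  have hτ'4 : τ'.card = 4 := h4 τ' hτ'C
  -- orthogonality of τ and τ'
  have hττ' : (τ ∩ τ').card = 2 :=
    card_inter_eq_two_of_types_ne C cl h4 hcompl hcl hne
      (by intro h; rcases h with ⟨h1, h2⟩ | ⟨h1, h2⟩ <;> simp_all) hτT hτ'T
  -- the quadrants
  have hq2 : (τ ∩ τ'ᶜ).card = 2 := by
    have := card_inter_add_card_inter_compl τ τ'; omega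
  have hq3 : (τᶜ ∩ τ').card = 2 := by
    have h1 := card_inter_add_card_inter_compl τ' τ
    rw [Finset.inter_comm τ' τ, Finset.inter_comm τ' τᶜ] at h1; omega
  have hq4 : (τᶜ ∩ τ'ᶜ).card = 2 := by
    have h1 := card_inter_add_card_inter_compl τᶜ τ'
    have hc : τᶜ.card = 4 := by rw [Finset.card_compl, hτ4]; rfl
    omega
  -- every member of the type is orthogonal to τ and τ'
  set T := typeRep C cl i j with hT
  have hortho : ∀ σ ∈ T, (σ ∩ τ).card = 2 ∧ (σ ∩ τ').card = 2 := by
    intro σ hσ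
    constructor
    · exact card_inter_eq_two_of_types_ne C cl h4 hcompl hcl hne
        (by intro h; rcases h with ⟨h1, h2⟩ | ⟨h1, h2⟩ <;> simp_all) hσ hτT
    · exact card_inter_eq_two_of_types_ne C cl h4 hcompl hcl hne
        (by intro h; rcases h with ⟨h1, h2⟩ | ⟨h1, h2⟩ <;> simp_all) hσ hτ'T
  have hσ4 : ∀ σ ∈ T, σ.card = 4 := fun σ hσ => h4 σ (mem_typeRep.1 hσ).1
  -- the quadrant counts of a member
  have hquad : ∀ σ ∈ T, (σ ∩ τ ∩ τ'ᶜ).card = 2 - (σ ∩ τ ∩ τ').card ∧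
      (σ ∩ τᶜ ∩ τ').card = 2 - (σ ∩ τ ∩ τ').card ∧
      (σ ∩ τᶜ ∩ τ'ᶜ).card = (σ ∩ τ ∩ τ').card ∧ (σ ∩ τ ∩ τ').card ≤ 2 := by
    intro σ hσ
    obtain ⟨h1, h2⟩ := hortho σ hσ
    have e1 := card_inter_add_card_inter_compl (σ ∩ τ) τ'
    have e2 := card_inter_add_card_inter_compl (σ ∩ τ') τ
    have e3 := card_eq_sum_quadrants σ τ τ'
    have hσc := hσ4 σ hσ
    have r1 : σ ∩ τ' ∩ τ = σ ∩ τ ∩ τ' := by rw [Finset.inter_assoc, Finset.inter_comm τ', ← Finset.inter_assoc]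
    have r2 : σ ∩ τ' ∩ τᶜ = σ ∩ τᶜ ∩ τ' := by rw [Finset.inter_assoc, Finset.inter_comm τ', ← Finset.inter_assoc]
    rw [r1, r2] at e2
    omega
  -- the two opposite-quadrant unions
  set Q14 : Finset (Fin 8) := (τ ∩ τ') ∪ (τᶜ ∩ τ'ᶜ) with hQ14
  set Q23 : Finset (Fin 8) := (τ ∩ τ'ᶜ) ∪ (τᶜ ∩ τ') with hQ23
  have hQ14c : Q14ᶜ = Q23 := by
    ext x; simp only [hQ14, hQ23, Finset.mem_compl, Finset.mem_union, Finset.mem_inter]; tauto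
  -- a member with unbalanced quadrant counts is one of the two unions
  have hunb : ∀ σ ∈ T, (σ ∩ τ ∩ τ').card ≠ 1 → σ = Q14 ∨ σ = Q23 := by
    intro σ hσT hn1
    obtain ⟨e2, e3, e4, hle⟩ := hquad σ hσT
    have hσc := hσ4 σ hσT
    have sub1 : σ ∩ τ ∩ τ' ⊆ τ ∩ τ' := fun x hx =>
      Finset.mem_inter.2 ⟨(Finset.mem_inter.1 (Finset.mem_inter.1 hx).1).2, (Finset.mem_inter.1 hx).2⟩
    have sub2 : σ ∩ τ ∩ τ'ᶜ ⊆ τ ∩ τ'ᶜ := fun x hx =>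
      Finset.mem_inter.2 ⟨(Finset.mem_inter.1 (Finset.mem_inter.1 hx).1).2, (Finset.mem_inter.1 hx).2⟩
    have sub3 : σ ∩ τᶜ ∩ τ' ⊆ τᶜ ∩ τ' := fun x hx =>
      Finset.mem_inter.2 ⟨(Finset.mem_inter.1 (Finset.mem_inter.1 hx).1).2, (Finset.mem_inter.1 hx).2⟩
    have sub4 : σ ∩ τᶜ ∩ τ'ᶜ ⊆ τᶜ ∩ τ'ᶜ := fun x hx =>
      Finset.mem_inter.2 ⟨(Finset.mem_inter.1 (Finset.mem_inter.1 hx).1).2, (Finset.mem_inter.1 hx).2⟩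
    rcases (show (σ ∩ τ ∩ τ').card = 0 ∨ (σ ∩ τ ∩ τ').card = 2 by omega) with h0 | h2
    · right
      have s2 : σ ∩ τ ∩ τ'ᶜ = τ ∩ τ'ᶜ := Finset.eq_of_subset_of_card_le sub2 (by omega)
      have s3 : σ ∩ τᶜ ∩ τ' = τᶜ ∩ τ' := Finset.eq_of_subset_of_card_le sub3 (by omega)
      have hsub : Q23 ⊆ σ := by
        intro x hx
        rw [hQ23, Finset.mem_union] at hx
        rcases hx with hx | hx
        · rw [← s2] at hx; exact (Finset.mem_inter.1 (Finset.mem_inter.1 hx).1).1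
        · rw [← s3] at hx; exact (Finset.mem_inter.1 (Finset.mem_inter.1 hx).1).1
      have hQc : Q23.card = 4 := by
        rw [hQ23, Finset.card_union_of_disjoint]
        · omega
        · rw [Finset.disjoint_left]; intro x h1 h2
          exact (Finset.mem_compl.1 (Finset.mem_inter.1 h2).1) (Finset.mem_inter.1 h1).1
      exact (Finset.eq_of_subset_of_card_le hsub (by omega)).symm
    · left
      have s1 : σ ∩ τ ∩ τ' = τ ∩ τ' := Finset.eq_of_subset_of_card_le sub1 (by omega)
      have s4 : σ ∩ τᶜ ∩ τ'ᶜ = τᶜ ∩ τ'ᶜ := Finset.eq_of_subset_of_card_le sub4 (by omega)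
      have hsub : Q14 ⊆ σ := by
        intro x hx
        rw [hQ14, Finset.mem_union] at hx
        rcases hx with hx | hx
        · rw [← s1] at hx; exact (Finset.mem_inter.1 (Finset.mem_inter.1 hx).1).1
        · rw [← s4] at hx; exact (Finset.mem_inter.1 (Finset.mem_inter.1 hx).1).1
      have hQc : Q14.card = 4 := by
        rw [hQ14, Finset.card_union_of_disjoint]
        · omega
        · rw [Finset.disjoint_left]; intro x h1 h2
          exact (Finset.mem_compl.1 (Finset.mem_inter.1 h2).1) (Finset.mem_inter.1 h1).1
      exact (Finset.eq_of_subset_of_card_le hsub (by omega)).symm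
  -- split the type into the unbalanced and balanced parts
  have hsplit := Finset.card_filter_add_card_filter_not (s := T)
    (p := fun σ => (σ ∩ τ ∩ τ').card = 1)
  -- (a) at most one unbalanced member (the two candidates are complementary)
  have hT0 : (T.filter fun σ => ¬ (σ ∩ τ ∩ τ').card = 1).card ≤ 1 := by
    rw [Finset.card_le_one]
    intro a ha b hb
    rw [Finset.mem_filter] at ha hb
    have haT := ha.1; have hbT := hb.1
    have hai : cl a = i := (mem_typeRep.1 haT).2.1
    have hbi : cl b = i := (mem_typeRep.1 hbT).2.1
    have haC : a ∈ C := (mem_typeRep.1 haT).1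
    have hbC : b ∈ C := (mem_typeRep.1 hbT).1
    rcases hunb a haT ha.2 with rfl | rfl <;> rcases hunb b hbT hb.2 with rfl | rfl
    · rfl
    · exfalso; apply hcl _ haC; rw [hQ14c, hbi, hai]
    · exfalso; apply hcl _ hbC; rw [hQ14c, hai, hbi]
    · rfl
  -- (b) at most five balanced members: their quadrant choices are a Kleitman family
  have hT1 : (T.filter fun σ => (σ ∩ τ ∩ τ').card = 1).card ≤ 5 := by
    obtain ⟨u1, v1, huv1, hq1'⟩ := Finset.card_eq_two.1 hττ'
    obtain ⟨u2, v2, huv2, hq2'⟩ := Finset.card_eq_two.1 hq2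
    obtain ⟨u3, v3, huv3, hq3'⟩ := Finset.card_eq_two.1 hq3
    obtain ⟨u4, v4, huv4, hq4'⟩ := Finset.card_eq_two.1 hq4
    set T1 := T.filter fun σ => (σ ∩ τ ∩ τ').card = 1 with hT1def
    have hbal : ∀ σ ∈ T1, (σ ∩ {u1, v1}).card = 1 ∧ (σ ∩ {u2, v2}).card = 1 ∧
        (σ ∩ {u3, v3}).card = 1 ∧ (σ ∩ {u4, v4}).card = 1 := by
      intro σ hσ
      rw [hT1def, Finset.mem_filter] at hσ
      obtain ⟨hσT, h1⟩ := hσ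
      obtain ⟨e2, e3, e4, -⟩ := hquad σ hσT
      rw [← hq1', ← hq2', ← hq3', ← hq4', ← Finset.inter_assoc, ← Finset.inter_assoc,
        ← Finset.inter_assoc, ← Finset.inter_assoc]
      omega
    let f : Finset (Fin 8) → (Fin 4 → Bool) :=
      fun σ => ![decide (v1 ∈ σ), decide (v2 ∈ σ), decide (v3 ∈ σ), decide (v4 ∈ σ)]
    have hmeet : ∀ σ ∈ T1, ∀ σ' ∈ T1,
        (σ ∩ σ').card = (Finset.univ.filter fun ℓ => f σ ℓ = f σ' ℓ).card := by
      intro σ hσ σ' hσ'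
      obtain ⟨a1, a2, a3, a4⟩ := hbal σ hσ
      obtain ⟨b1, b2, b3, b4⟩ := hbal σ' hσ'
      rw [card_eq_sum_quadrants (σ ∩ σ') τ τ']
      have q1 : σ ∩ σ' ∩ τ ∩ τ' = σ ∩ σ' ∩ {u1, v1} := by rw [Finset.inter_assoc (σ ∩ σ') τ τ', hq1']
      have q2 : σ ∩ σ' ∩ τ ∩ τ'ᶜ = σ ∩ σ' ∩ {u2, v2} := by rw [Finset.inter_assoc (σ ∩ σ') τ τ'ᶜ, hq2']
      have q3 : σ ∩ σ' ∩ τᶜ ∩ τ' = σ ∩ σ' ∩ {u3, v3} := by rw [Finset.inter_assoc (σ ∩ σ') τᶜ τ', hq3']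
      have q4 : σ ∩ σ' ∩ τᶜ ∩ τ'ᶜ = σ ∩ σ' ∩ {u4, v4} := by
        rw [Finset.inter_assoc (σ ∩ σ') τᶜ τ'ᶜ, hq4']
      rw [q1, q2, q3, q4, card_inter_inter_pair huv1 a1 b1, card_inter_inter_pair huv2 a2 b2,
        card_inter_inter_pair huv3 a3 b3, card_inter_inter_pair huv4 a4 b4, Finset.card_filter,
        Fin.sum_univ_four]
      simp [f]
    have hdis : ∀ σ ∈ T1, ∀ σ' ∈ T1, (Finset.univ.filter fun ℓ => f σ ℓ ≠ f σ' ℓ).card ≤ 2 := by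
      intro σ hσ σ' hσ'
      have hagree := hmeet σ hσ σ' hσ'
      have hsum : (Finset.univ.filter fun ℓ => f σ ℓ = f σ' ℓ).card +
          (Finset.univ.filter fun ℓ => f σ ℓ ≠ f σ' ℓ).card = 4 := by
        have := Finset.card_filter_add_card_filter_not (s := (Finset.univ : Finset (Fin 4)))
          (p := fun ℓ => f σ ℓ = f σ' ℓ)
        rwa [Finset.card_univ, Fintype.card_fin] at this
      by_cases heq : σ = σ'
      · subst heq; simp
      · have hσT : σ ∈ T := (Finset.mem_filter.1 hσ).1
        have hσ'T : σ' ∈ T := (Finset.mem_filter.1 hσ').1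
        have := card_inter_mem_of_type_eq C cl h4 hcompl hcl hne hσT hσ'T heq
        omega
    have hinj : Set.InjOn f T1 := by
      intro σ hσ σ' hσ' hf
      have hagree := hmeet σ hσ σ' hσ'
      rw [hf, Finset.filter_true_of_mem (fun _ _ => rfl), Finset.card_univ, Fintype.card_fin] at hagree
      have hσc := hσ4 σ (Finset.mem_filter.1 hσ).1
      have hσ'c := hσ4 σ' (Finset.mem_filter.1 hσ').1
      have e1 : σ ∩ σ' = σ := Finset.eq_of_subset_of_card_le Finset.inter_subset_left (by omega)
      have e2 : σ ∩ σ' = σ' := Finset.eq_of_subset_of_card_le Finset.inter_subset_right (by omega)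
      rw [← e1, e2]
    rw [← Finset.card_image_of_injOn hinj]
    apply kleitman_fun
    intro g hg g' hg'
    rw [Finset.mem_image] at hg hg'
    obtain ⟨σ, hσ, rfl⟩ := hg
    obtain ⟨σ', hσ', rfl⟩ := hg'
    exact hdis σ hσ σ' hσ'
  omega

end Quadrants

end PercRepro
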